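import Summits.QuantumFields.YangMills.Theorems.BalabanUVNodesN10EntryLettersOfN06RecordFaceC
import Literature.MathematicalPhysics.QuantumFieldTheory.Balaban1983to89.B13InverseLettersNeumannRadius

/-!
# BalabanUVNodes ∕ N10 ([B13], `Dag.B13_main`) ← N06 ([B9], `Dag.B9_main`): NODE A's COMPLEX-BALL LETTER FOR THE INVERSE PIECE AT N06's RECORD FACE
# BY SECT. B's NEUMANN ROAD — THE THIN RADIUS AND THE RATE SPLIT LOCATED (file D of module 55; sibling of 58B, not an in-place edit)

Track A of `YM-PLAN.md` (cell `pub-ymgap`, HUMAN RULING D-0062 ∕ D-0149), DAG in-edge **N06 → N10**; width seat `pub-ymgap-dag-n10-w2` g2 on the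
n10-c lane's module-60 lineage (lane word «GO, name it `…RecordFaceD`», bus 2026-08-28T01:40:09Z).  A HELPER for the N10 entrywise junction
editions (module 67 `…N10B13KernelTowerWalksEntrywiseNumeralsDecorated`, binder `hEL` at the rung's chart radius `rf.R`).

WHAT.  Module 58B `…N10EntryLettersOfN06RecordFaceC.rawEntryLetters_inv_at_member_neumann` ([B9] Sect. B p. 402 ∕ p. 403 ll. 3–5: the propagator at
a complex configuration near a real one is the Neumann series (3.64) around the real propagator — Theorem 3.10 at ONE real background) displays, after
N06's schema block and the complexification `hAL ∕ hslice0`, FIVE NUMERIC BINDERS `hμ : 0 < μ`, `h3μ : 3μ ≤ ((1−2q.α)q.δ₀)·sℓ x`, `hR₁ : 0 < R₁`,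
`hR₁R : R₁ ≤ R_an`, `hsmall : 2B_A·R₁∕R_an·(q.C d_q·(ℓmax x)²)·(mX·c₀(1,μ)^ν)² ≤ ½` (print's «for α₁ sufficiently small»).  THIS FILE discharges them by
`B13InverseLettersNeumannRadius` (width seat n10-w2 g2): for a TARGET RATE `0 ≤ ρ′ < ((1−2q.α)q.δ₀)·sℓ x` the inverse family has letters at the EXPLICIT
located radius `R₁⋆ = R_an ∕ (4·B_A·(q.C d_q (ℓmax x)²)·(mX·c₀(1,μ⋆)^ν)² + 1)`, `μ⋆ = (((1−2q.α)q.δ₀)·sℓ x − ρ′)∕3`, and at every `R′ ≤ R₁⋆`.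
* ★★ `rawEntryLetters_inv_at_member_neumann_located` — 58B's binders VERBATIM minus the five, plus `0 < R_an`, `0 ≤ ρ′ < ((1−2q.α)q.δ₀)·sℓ x`;
  conclusion `RawEntryLetters (u ↦ Aop(u)⁻¹) (loc x ∘ (𝔬A x).blk) R₁⋆ ρ′ (2·q.C d_q·(ℓmax x)²)`.
* `rawEntryLetters_inv_at_member_neumann_located_of_le` — the same at every `R′ ≤ R₁⋆`: at the junction the five binders of an inverse factor read as
  ONE located inequality `rf.R ≤ R₁⋆(letters of the factor)` (cf. `B13Bound226Numerals` `θ₀ ≤ θ₀max`, `B13CondTowerAccretiveFloor` `rf.m₀ ≤ m⋆`).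
A2 ∕ A6.  N06's schema block is N06's (displayed verbatim, as in 55B ∕ 56B ∕ 58B); the analytic block (`hAL`, `hslice0`-shape, fibre bound) is jointly
inhabited with genuine `u`-dependence by `B13InverseLettersNeumannRadius.rawEntryLetters_inv_of_neumann_toy_located` (every pair of rates `0 ≤ ρ′ < ρ`).
HONEST FRAMING.  Kernel bookkeeping ([folklore] arithmetic + `rawEntryLetters_mono` behind 58B); COUNT-NEUTRAL; nothing of [B9] or [II] asserted:
Theorem 3.10 for `G(U₀)` is N06's displayed schema (GAPS G-B9-05∕06a∕07), the reading is NODE 00's dictionary, the complexification `Aop ∕ hAL ∕ hslice0`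
is the [II] p. 15 in-edge; dag-n10-d's ₁₃ pin algebra untouched; 58B not edited.  NEITHER N06 NOR N10 IS DISCHARGED; K1⁷ NOT closed; counts UNMOVED.
One finite 𝕋⁴ programme at fixed `ε`, Bałaban AS PRINTED — R4 closes the conditional finite-𝕋⁴ rung `BalabanLadder.UV` only; the YM mass gap (Clay) is
NOT proved by any of this; NOT continuum, NOT OS.  0 `def`, 0 `sorry`, standard axioms.
-/

noncomputable section

namespace Summit.QuantumFields.YangMills.BalabanUVNodes.N10EntryLettersOfN06RecordFaceD

open Metric Set Finset
open scoped Matrix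
open Literature.MathematicalPhysics.QuantumFieldTheory.Balaban1983to89
open Literature.MathematicalPhysics.QuantumFieldTheory.Balaban1983to89.B6RandomWalk (Ineq261)
open Literature.MathematicalPhysics.QuantumFieldTheory.Balaban1983to89.B9Thm34Ext (toB6)
open Literature.MathematicalPhysics.QuantumFieldTheory.Balaban1983to89.B9Thm37GlueTorus (tdist1)
open Literature.MathematicalPhysics.QuantumFieldTheory.Balaban1983to89.B5TorusCover (UT)
open Literature.MathematicalPhysics.QuantumFieldTheory.Balaban1983to89.B9Thm310Whole
  (Ops310 StaticOK310 Sizes310 Local342G Identities310)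
open Literature.MathematicalPhysics.QuantumFieldTheory.Balaban1983to89.B9RWSumsDefinitePins (PinPrims)
open Literature.MathematicalPhysics.QuantumFieldTheory.Balaban1983to89.B9RWSums347DefiniteFaces (exp261)
open Literature.MathematicalPhysics.QuantumFieldTheory.Balaban1983to89.B9PinMembersKLevelV1 (MemberY geo9Y)
open Literature.MathematicalPhysics.QuantumFieldTheory.Balaban1983to89.B13EntrywiseWalks (RawEntryLetters)
open Literature.MathematicalPhysics.QuantumFieldTheory.Balaban1983to89.B13EntryLetterAlgebra (rawEntryLetters_mono)
open Literature.MathematicalPhysics.QuantumFieldTheory.Balaban1983to89.B13InverseLettersNeumannRadius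
  (thinRadius_pos thinRadius_le smallness_thinRadius)
open Summit.QuantumFields.YangMills.BalabanUVNodes.N10EntryLettersOfN06RecordFaceC (rawEntryLetters_inv_at_member_neumann)

variable {d ℓ : ℕ} {hd : 1 ≤ d + 1} {hL : Odd (ℓ + 1) ∧ 1 < ℓ + 1} {b₀ b₁ : ℝ} {Mstar : ℕ}
variable [∀ x : MemberY d ℓ hd hL b₀ b₁ Mstar, Fintype (geo9Y x).Site]
  [∀ x : MemberY d ℓ hd hL b₀ b₁ Mstar, DecidableEq (geo9Y x).Site]
variable {c35 : ℝ} {bg : MemberY d ℓ hd hL b₀ b₁ Mstar → B9.Backgrounds}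
variable {X Y ι A : MemberY d ℓ hd hL b₀ b₁ Mstar → Type}
  [∀ x, Fintype (X x)] [∀ x, DecidableEq (X x)] [∀ x, Fintype (Y x)] [∀ x, DecidableEq (Y x)] [∀ x, Fintype (ι x)]
  [∀ x, Fintype (A x)]
variable {ν : ℕ} {Nf : Fin ν → ℕ} [∀ i, NeZero (Nf i)]
variable {E : Type*} [NormedAddCommGroup E] [NormedSpace ℂ E]

/-! ## §1. The inverse piece at a member by the Neumann road — thin radius and rate split located -/

/-- ★★ **NODE A's COMPLEX-BALL LETTER FOR THE INVERSE AT ONE MEMBER, THIN RADIUS LOCATED** (58B with `hμ h3μ hR₁ hR₁R hsmall` discharged).  Inputs: N06's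
binders as in 55B ∕ 58B (`hc35 q hq H 𝔬A κA hstA hκA h36A` + `h261`); the located reading per member (`loc`, `sℓ`, `ℓmax`); the member's regime and `α₀`; ONE
background `U₀ ∈ Reg335 c₃₅ α₀` (the centre of the chart); the complexified operator `Aop` with `Aop 0 = M((𝔬A x).Δa U₀)` (`hslice0`) and letters `hAL` at
rate `((1−2q.α)q.δ₀)·sℓ x` on the `R_an`-ball; a fibre bound `mX`; `0 < R_an`; a target rate `0 ≤ ρ′ < ((1−2q.α)q.δ₀)·sℓ x`.  Conclusion: `u ↦ Aop(u)⁻¹` has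
letters `(R₁⋆, ρ′, 2·q.C d_q·(ℓmax x)²)` at the explicit radius `R₁⋆ = R_an ∕ (4·B_A·(q.C d_q (ℓmax x)²)·(mX·c₀(1,μ⋆)^ν)² + 1)`, `μ⋆ = (((1−2q.α)q.δ₀)·sℓ x − ρ′)∕3`.
[cite: Balaban1985BackgroundPropagators, (3.26)–(3.27) p.395, (3.35) p.396, Thm 3.4 p.400, (3.60)–(3.65) p.402, (3.86) p.407, Thm 3.10 (3.105)–(3.108) pp.414–416;
Balaban1984PropagatorsII, Lemma 2.1 (2.61) p.234; Balaban1988RG2Cluster, p.13, p.15; Balaban1987RG1, (1.13)–(1.14) p.262] -/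
theorem rawEntryLetters_inv_at_member_neumann_located (hc35 : 0 < c35) (q : PinPrims) (hq : q.OK)
    (H : MemberY d ℓ hd hL b₀ b₁ Mstar → Prop)
    (𝔬A : ∀ x : MemberY d ℓ hd hL b₀ b₁ Mstar, Ops310 (geo9Y x) (bg x) (X x) (Y x) (ι x) (A x))
    (κA : MemberY d ℓ hd hL b₀ b₁ Mstar → Sizes310)
    (hstA : ∀ x, StaticOK310 (𝔬A x) q.ρ q.Nc q.N' q.NF q.Cℓ (κA x)) (hκA : ∀ x, (κA x).Bounded q.Kc)
    (h36A : ∀ x, q.M₁ ≤ (geo9Y x).M → ∀ α₀ : ℝ, 0 < α₀ → c35 * (geo9Y x).M * α₀ ≤ q.a₁ →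
      ∀ U : (bg x).Cfg, (bg x).Reg335 c35 α₀ U →
        Local342G (𝔬A x) 1 (H x) q.B₀ q.δ₀ U ∧ B9Thm310Whole.Factors389 (𝔬A x) 1 (H x) q.θ₀ q.δ₀ U ∧
          Identities310 (𝔬A x) 1 (H x) U)
    {ML : ℝ} (h261 : ∀ x, ML ≤ (geo9Y x).M →
      Ineq261 (exp261 (@geo9Y d ℓ hd hL b₀ b₁ Mstar) q.δ₀ q.α) (toB6 (geo9Y x) 1 (H x)) q.δ₀ q.α)
    (loc : ∀ x : MemberY d ℓ hd hL b₀ b₁ Mstar, (geo9Y x).Site → UT Nf) (sℓ ℓmax : MemberY d ℓ hd hL b₀ b₁ Mstar → ℝ)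
    (hloc : ∀ x a b, sℓ x * tdist1 Nf (loc x a) (loc x b) ≤ (geo9Y x).dist a b)
    (hlen : ∀ x a, (geo9Y x).len a ≤ ℓmax x)
    (x : MemberY d ℓ hd hL b₀ b₁ Mstar)
    (hM : max q.M₁ (max ML (max 1 (2 * q.NF * q.θ₀ * B6.c1 (exp261 (@geo9Y d ℓ hd hL b₀ b₁ Mstar) q.δ₀ q.α) q.δ₀ q.α))) ≤
      (geo9Y x).M)
    {α₀ : ℝ} (hα : 0 < α₀) (ha : (geo9Y x).M * α₀ ≤ q.a₁ / c35)
    -- ONE background of the class (3.35) at the centre of the chart, and the complexified `Δ_a` on the chart ball ([II] p. 15 in-edge)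
    (U₀ : (bg x).Cfg) (hU₀ : (bg x).Reg335 c35 α₀ U₀)
    {Aop : E → Matrix (X x) (X x) ℂ} {Ran BA : ℝ} {mX : ℕ}
    (hAL : RawEntryLetters Aop (loc x ∘ (𝔬A x).blk) Ran (((1 - 2 * q.α) * q.δ₀) * sℓ x) BA)
    (hslice0 : Aop 0 = (LinearMap.toMatrix' ((𝔬A x).Δa U₀)).map (algebraMap ℝ ℂ))
    (hfibX : ∀ y : UT Nf, (univ.filter fun k => (loc x ∘ (𝔬A x).blk) k = y).card ≤ mX)
    -- the located numerics: the big radius is positive and a target rate below the reading's rate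
    (hRan : 0 < Ran) {ρ' : ℝ} (hρ'0 : 0 ≤ ρ') (hρ' : ρ' < ((1 - 2 * q.α) * q.δ₀) * sℓ x) :
    RawEntryLetters (fun u => (Aop u)⁻¹) (loc x ∘ (𝔬A x).blk)
      (Ran / (4 * (BA * (q.C (exp261 (@geo9Y d ℓ hd hL b₀ b₁ Mstar) q.δ₀ q.α) * ℓmax x ^ 2) *
        (mX * B6.c0 1 ((((1 - 2 * q.α) * q.δ₀) * sℓ x - ρ') / 3) ^ ν) *
        (mX * B6.c0 1 ((((1 - 2 * q.α) * q.δ₀) * sℓ x - ρ') / 3) ^ ν)) + 1))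
      ρ' (2 * (q.C (exp261 (@geo9Y d ℓ hd hL b₀ b₁ Mstar) q.δ₀ q.α) * ℓmax x ^ 2)) := by
  have hμ : 0 < (((1 - 2 * q.α) * q.δ₀) * sℓ x - ρ') / 3 := by linarith
  have h3μ : 3 * ((((1 - 2 * q.α) * q.δ₀) * sℓ x - ρ') / 3) ≤ ((1 - 2 * q.α) * q.δ₀) * sℓ x := by
    have e3 : 3 * ((((1 - 2 * q.α) * q.δ₀) * sℓ x - ρ') / 3) = ((1 - 2 * q.α) * q.δ₀) * sℓ x - ρ' := by ring
    rw [e3]; linarith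
  have hS : 0 ≤ (mX : ℝ) * B6.c0 1 ((((1 - 2 * q.α) * q.δ₀) * sℓ x - ρ') / 3) ^ ν :=
    mul_nonneg (Nat.cast_nonneg _) (pow_nonneg (B6RandomWalk.c0_nonneg 1 _) ν)
  have hBG : 0 ≤ q.C (exp261 (@geo9Y d ℓ hd hL b₀ b₁ Mstar) q.δ₀ q.α) * ℓmax x ^ 2 :=
    mul_nonneg (PinPrims.C_nonneg hq _) (sq_nonneg _)
  have hT : 0 ≤ BA * (q.C (exp261 (@geo9Y d ℓ hd hL b₀ b₁ Mstar) q.δ₀ q.α) * ℓmax x ^ 2) *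
      (mX * B6.c0 1 ((((1 - 2 * q.α) * q.δ₀) * sℓ x - ρ') / 3) ^ ν) *
      (mX * B6.c0 1 ((((1 - 2 * q.α) * q.δ₀) * sℓ x - ρ') / 3) ^ ν) :=
    mul_nonneg (mul_nonneg (mul_nonneg hAL.B_nonneg hBG) hS) hS
  have h := rawEntryLetters_inv_at_member_neumann (E := E) (Nf := Nf) hc35 q hq H 𝔬A κA hstA hκA h36A h261 loc sℓ ℓmax hloc hlen x hM
    hα ha U₀ hU₀ hAL hslice0 hfibX hμ h3μ (thinRadius_pos hRan hT) (thinRadius_le hRan.le hT)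
    (smallness_thinRadius hRan hAL.B_nonneg hBG hS)
  have e : ((1 - 2 * q.α) * q.δ₀) * sℓ x - 3 * ((((1 - 2 * q.α) * q.δ₀) * sℓ x - ρ') / 3) = ρ' := by ring
  rw [e] at h
  exact h

/-- **… AT EVERY SMALLER RADIUS** `R′ ≤ R₁⋆` (module 34 `rawEntryLetters_mono`): the N10 junction reads `hEL` at the rung's chart radius `rf.R`, so the
five binders of an inverse factor at the member become the located inequality `rf.R ≤ R₁⋆`.
[cite: Balaban1985BackgroundPropagators, (3.62)–(3.64) p.402, Thm 3.10 (3.108) p.416; Balaban1988RG2Cluster, p.15] -/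
theorem rawEntryLetters_inv_at_member_neumann_located_of_le (hc35 : 0 < c35) (q : PinPrims) (hq : q.OK)
    (H : MemberY d ℓ hd hL b₀ b₁ Mstar → Prop)
    (𝔬A : ∀ x : MemberY d ℓ hd hL b₀ b₁ Mstar, Ops310 (geo9Y x) (bg x) (X x) (Y x) (ι x) (A x))
    (κA : MemberY d ℓ hd hL b₀ b₁ Mstar → Sizes310)
    (hstA : ∀ x, StaticOK310 (𝔬A x) q.ρ q.Nc q.N' q.NF q.Cℓ (κA x)) (hκA : ∀ x, (κA x).Bounded q.Kc)
    (h36A : ∀ x, q.M₁ ≤ (geo9Y x).M → ∀ α₀ : ℝ, 0 < α₀ → c35 * (geo9Y x).M * α₀ ≤ q.a₁ →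
      ∀ U : (bg x).Cfg, (bg x).Reg335 c35 α₀ U →
        Local342G (𝔬A x) 1 (H x) q.B₀ q.δ₀ U ∧ B9Thm310Whole.Factors389 (𝔬A x) 1 (H x) q.θ₀ q.δ₀ U ∧
          Identities310 (𝔬A x) 1 (H x) U)
    {ML : ℝ} (h261 : ∀ x, ML ≤ (geo9Y x).M →
      Ineq261 (exp261 (@geo9Y d ℓ hd hL b₀ b₁ Mstar) q.δ₀ q.α) (toB6 (geo9Y x) 1 (H x)) q.δ₀ q.α)
    (loc : ∀ x : MemberY d ℓ hd hL b₀ b₁ Mstar, (geo9Y x).Site → UT Nf) (sℓ ℓmax : MemberY d ℓ hd hL b₀ b₁ Mstar → ℝ)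
    (hloc : ∀ x a b, sℓ x * tdist1 Nf (loc x a) (loc x b) ≤ (geo9Y x).dist a b)
    (hlen : ∀ x a, (geo9Y x).len a ≤ ℓmax x)
    (x : MemberY d ℓ hd hL b₀ b₁ Mstar)
    (hM : max q.M₁ (max ML (max 1 (2 * q.NF * q.θ₀ * B6.c1 (exp261 (@geo9Y d ℓ hd hL b₀ b₁ Mstar) q.δ₀ q.α) q.δ₀ q.α))) ≤
      (geo9Y x).M)
    {α₀ : ℝ} (hα : 0 < α₀) (ha : (geo9Y x).M * α₀ ≤ q.a₁ / c35)
    (U₀ : (bg x).Cfg) (hU₀ : (bg x).Reg335 c35 α₀ U₀)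
    {Aop : E → Matrix (X x) (X x) ℂ} {Ran BA : ℝ} {mX : ℕ}
    (hAL : RawEntryLetters Aop (loc x ∘ (𝔬A x).blk) Ran (((1 - 2 * q.α) * q.δ₀) * sℓ x) BA)
    (hslice0 : Aop 0 = (LinearMap.toMatrix' ((𝔬A x).Δa U₀)).map (algebraMap ℝ ℂ))
    (hfibX : ∀ y : UT Nf, (univ.filter fun k => (loc x ∘ (𝔬A x).blk) k = y).card ≤ mX)
    (hRan : 0 < Ran) {ρ' : ℝ} (hρ'0 : 0 ≤ ρ') (hρ' : ρ' < ((1 - 2 * q.α) * q.δ₀) * sℓ x) {R' : ℝ}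
    (hR' : R' ≤ Ran / (4 * (BA * (q.C (exp261 (@geo9Y d ℓ hd hL b₀ b₁ Mstar) q.δ₀ q.α) * ℓmax x ^ 2) *
        (mX * B6.c0 1 ((((1 - 2 * q.α) * q.δ₀) * sℓ x - ρ') / 3) ^ ν) *
        (mX * B6.c0 1 ((((1 - 2 * q.α) * q.δ₀) * sℓ x - ρ') / 3) ^ ν)) + 1)) :
    RawEntryLetters (fun u => (Aop u)⁻¹) (loc x ∘ (𝔬A x).blk) R' ρ'
      (2 * (q.C (exp261 (@geo9Y d ℓ hd hL b₀ b₁ Mstar) q.δ₀ q.α) * ℓmax x ^ 2)) :=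
  rawEntryLetters_mono (rawEntryLetters_inv_at_member_neumann_located (E := E) (Nf := Nf) hc35 q hq H 𝔬A κA hstA hκA h36A h261 loc sℓ ℓmax
    hloc hlen x hM hα ha U₀ hU₀ hAL hslice0 hfibX hRan hρ'0 hρ') hR' le_rfl le_rfl

end Summit.QuantumFields.YangMills.BalabanUVNodes.N10EntryLettersOfN06RecordFaceD

end
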